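import Literature.Analysis.FluidPDE.HardSphereDynamics
import Literature.Analysis.FluidPDE.PolydisperseCollisionLaw
import HarnessLib

/-!
# Polydisperse hard-sphere (hard-body mixture) dynamics: trajectories and the flow

The hard-body flow of `N` particles with **per-particle masses** `m : Fin N → ℝ` and
**per-particle diameters** `σ : Fin N → ℝ` in a position geometry `G : Geometry d X`
(`Torus.geometry d` on `T^d`, `Euclidean.geometry d` on `ℝ^d`), generalising the monodisperse
unit-mass `IsHardSphereTrajectory` / `HardSphereFlow` of `HardSphereDynamics` to mixtures
(Ampatzoglou–Miller–Pavlović 2022 §3, two species of hard spheres in `ℝ^d`; Spohn 1991 §8.2,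
the Rayleigh gas — a tracer sphere among ideal-gas point particles; Dürr–Goldstein–Lebowitz 1981,
the mechanical model of Brownian motion). The static vocabulary (mass collision law
`reflectVelMass` / `collidePairMass`, additive contact distance `contactRadius`, mixture domain
`polyHardSphereDomain`, contact sets `polyContactSet` of *interacting* pairs — pairs of zero
contact distance, i.e. two point particles, never interact — and the Liouville measure
`polyLiouville`) is `Literature.Analysis.FluidPDE.PolydisperseCollisionLaw`. Here:

* `polyCollisionTimes G σ γ` — the collision (contact) times of a curve in phase space;
* `IsPolyHardSphereTrajectory G m σ γ` — free flight, locally finitely many collision times,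
  continuous positions, binary non-grazing collisions from a pre-collisional left limit by the
  mass law, right-continuous (the shape of `IsHardSphereTrajectory`, AMP 2022 §3.2–3.3);
* `PolydisperseHardSphereFlow G m σ` — the **hypothesis structure** of the a.e.-defined global
  flow (Alexander-type theorem; AMP 2022 Thm 3.1): a measurable invariant good set of full
  Liouville measure in the mixture domain on which the flow is a measurable one-parameter group
  of polydisperse trajectories preserving `polyLiouville G σ` (masses enter the collision law
  only; plain Lebesgue measure is invariant). Its EXISTENCE statements are the named facts of
  `Literature.Analysis.FluidPDE.PolydisperseHardSphereAlexander`, kept in a separate file so that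
  this definition file carries no undischarged fact;
* the **monodisperse embedding** `IsHardSphereTrajectory.toPoly`, `HardSphereFlow.toPoly`: a
  hard-sphere flow of diameter `ε > 0` is a polydisperse flow with constant diameter `ε` and any
  constant mass `μ ≠ 0` — in particular the structure is inhabited by the flows of
  `HardSphereAlexander` / `HardSphereEuclideanAlexander`.

Typical instance (Einstein-bath / tagged-particle statements): `n` spheres of mass `1` and
diameter `ε` plus `k` points of mass `μ` and diameter `0` on `T³` is
`PolydisperseHardSphereFlow (Torus.geometry (Fin 3)) (Fin.append (fun _ : Fin n => 1)
(fun _ : Fin k => μ)) (Fin.append (fun _ => ε) (fun _ => 0))`.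

## Mathlib / Literature reuse

`Geometry`, `Config`, `freeFlight`, `IsIncoming`, `collisionTimes`, `IsHardSphereTrajectory`,
`HardSphereFlow` are the tree's; `MeasurePreserving`, `Measure.map`, `nhdsWithin` (`𝓝[<] t`),
`Set.Finite` are Mathlib's. Mathlib has no hard-ball / billiard flow.

## Design choices

Same as `HardSphereDynamics`: right-continuous trajectories, a structure of hypotheses (the
construction is research-level measure theory; only its properties are consumed downstream),
`N` implicit in `m σ : Fin N → ℝ`.

## References

* I. Ampatzoglou, J. K. Miller, N. Pavlović, *A rigorous derivation of a Boltzmann system for a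
  mixture of hard-sphere gases*, SIAM J. Math. Anal. 54 (2022), arXiv:2104.14480, §3, Thm 3.1.
* H. Spohn, *Large Scale Dynamics of Interacting Particles* (1991), §8.2, p. 106.
* D. Dürr, S. Goldstein, J. L. Lebowitz, *A mechanical model of Brownian motion*, Comm. Math.
  Phys. 78 (1981) 507–530.
* R. K. Alexander, *The infinite hard sphere system*, PhD thesis, Berkeley (1975).
-/

open MeasureTheory Set Filter
open scoped Topology

namespace Literature.Analysis.FluidPDE

noncomputable section

section Flow

variable {d : Type*} [Fintype d] {X : Type*} {N : ℕ}

/-- The collision times of a curve `γ` in phase space: times `t` at which some interacting pair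
`i ≠ j` is in contact, `γ t ∈ polyContactSet G σ i j` (AMP 2022 §3.2, the stopping times `τ`). [cite: AmpatzoglouMillerPavlovic2022, §3.2] -/
def polyCollisionTimes (G : Geometry d X) (σ : Fin N → ℝ) (γ : ℝ → Config N d X) : Set ℝ :=
  {t | ∃ i j : Fin N, i ≠ j ∧ γ t ∈ polyContactSet G σ i j}

/-- Membership in the set of collision times. [folklore] -/
theorem mem_polyCollisionTimes {G : Geometry d X} {σ : Fin N → ℝ} {γ : ℝ → Config N d X} {t : ℝ} :
    t ∈ polyCollisionTimes G σ γ ↔ ∃ i j : Fin N, i ≠ j ∧ γ t ∈ polyContactSet G σ i j :=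
  Iff.rfl

/-- Monodisperse case: for a constant positive diameter the collision times are those of
`HardSphereDynamics`. [folklore] -/
theorem polyCollisionTimes_const (G : Geometry d X) {ε : ℝ} (hε : 0 < ε) (γ : ℝ → Config N d X) :
    polyCollisionTimes G (fun _ : Fin N => ε) γ = collisionTimes G ε γ := by
  ext t
  simp [mem_polyCollisionTimes, mem_collisionTimes, polyContactSet_const G hε]

/-- The mixture domain is measurable as soon as the separation map is (jointly) measurable (true
for both geometries: `Torus.measurable_geometry_sepVec`, `Euclidean.measurable_geometry_sepVec`). [folklore] -/
theorem measurableSet_polyHardSphereDomain [MeasurableSpace X] (G : Geometry d X)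
    (hG : Measurable fun p : X × X => G.sepVec p.1 p.2) (σ : Fin N → ℝ) :
    MeasurableSet (polyHardSphereDomain G σ) := by
  have : polyHardSphereDomain G σ =
      ⋂ i, ⋂ j, {z : Config N d X | i ≠ j → contactRadius σ i j ≤ ‖G.sepVec (z i).1 (z j).1‖} := by
    ext z
    simp [mem_polyHardSphereDomain]
  rw [this]
  refine MeasurableSet.iInter fun i => MeasurableSet.iInter fun j => ?_
  by_cases hij : i = j
  · simp [hij]
  simp only [ne_eq, hij, not_false_eq_true, forall_const]
  have hm : Measurable fun z : Config N d X => G.sepVec (z i).1 (z j).1 :=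
    hG.comp ((measurable_pi_apply i).fst.prodMk (measurable_pi_apply j).fst)
  exact measurableSet_le measurable_const hm.norm

/-- Contact sets are measurable (under the same measurability of the separation map). [folklore] -/
theorem measurableSet_polyContactSet [MeasurableSpace X] (G : Geometry d X)
    (hG : Measurable fun p : X × X => G.sepVec p.1 p.2) (σ : Fin N → ℝ) (i j : Fin N) :
    MeasurableSet (polyContactSet G σ i j) := by
  have hm : Measurable fun z : Config N d X => G.sepVec (z i).1 (z j).1 :=
    hG.comp ((measurable_pi_apply i).fst.prodMk (measurable_pi_apply j).fst)
  by_cases hr : 0 < contactRadius σ i j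
  · have : polyContactSet G σ i j =
        polyHardSphereDomain G σ ∩ {z | ‖G.sepVec (z i).1 (z j).1‖ = contactRadius σ i j} := by
      ext z
      simp [mem_polyContactSet, hr]
    rw [this]
    exact (measurableSet_polyHardSphereDomain G hG σ).inter
      (measurableSet_eq_fun hm.norm measurable_const)
  · have : polyContactSet G σ i j = ∅ := by
      ext z
      simp [mem_polyContactSet, hr]
    rw [this]
    exact MeasurableSet.empty

/-- The number of collisions of the curve `γ` in the time window `[a, b]` (`Set.ncard`, junk value
`0` if infinite — it is finite for a polydisperse trajectory, `locFinite`). [folklore] -/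
def polyNumCollisions (G : Geometry d X) (σ : Fin N → ℝ) (γ : ℝ → Config N d X) (a b : ℝ) : ℕ :=
  (polyCollisionTimes G σ γ ∩ Icc a b).ncard

/-- `γ : ℝ → Config N d X` is a *polydisperse hard-body trajectory* with masses `m` and diameters
`σ` in the geometry `G` (AMP 2022 §3.2–3.3, the mixed-particle flow; the shape of
`IsHardSphereTrajectory`): it lives in the mixture domain, its collision times are locally
finite, positions are continuous, it is free flight on every collision-free interval `(s, t]`,
and at a collision time exactly one (interacting) pair `{i, j}` is in contact, the left limit
`z⁻` exists and is pre-collisional (no grazing) and `γ t = collidePairMass G m i j z⁻` (elastic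
jump with masses; right-continuous). Pairs with zero contact distance never collide. [cite: AmpatzoglouMillerPavlovic2022, §3.2–3.3] -/
structure IsPolyHardSphereTrajectory [TopologicalSpace X] (G : Geometry d X) (m σ : Fin N → ℝ)
    (γ : ℝ → Config N d X) : Prop where
  /-- The trajectory stays in the mixture domain. -/
  mem : ∀ t, γ t ∈ polyHardSphereDomain G σ
  /-- Collision times are locally finite. -/
  locFinite : ∀ a b, (polyCollisionTimes G σ γ ∩ Icc a b).Finite
  /-- Positions are continuous in time. -/
  pos_continuous : ∀ i, Continuous fun t => (γ t i).1
  /-- Free flight on collision-free intervals `(s, t]`. -/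
  free : ∀ s t, s ≤ t → (∀ τ ∈ Ioc s t, τ ∉ polyCollisionTimes G σ γ) →
    γ t = freeFlight G (t - s) (γ s)
  /-- At a collision time a single interacting pair collides, from a pre-collisional left limit,
  by the elastic law with masses. -/
  binary : ∀ t (i j : Fin N), i ≠ j → γ t ∈ polyContactSet G σ i j →
    (∀ i' j' : Fin N, i' ≠ j' → γ t ∈ polyContactSet G σ i' j' →
      ({i', j'} : Finset (Fin N)) = {i, j}) ∧
    ∃ zl, Tendsto γ (𝓝[<] t) (𝓝 zl) ∧ IsIncoming G zl i j ∧ γ t = collidePairMass G m i j zl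

namespace IsPolyHardSphereTrajectory

variable [TopologicalSpace X] {G : Geometry d X} {m σ : Fin N → ℝ} {γ : ℝ → Config N d X}

/-- On a polydisperse trajectory the number of collisions in `[a, b]` is the cardinality of the
finite set of collision times in `[a, b]`. [folklore] -/
theorem polyNumCollisions_eq (h : IsPolyHardSphereTrajectory G m σ γ) (a b : ℝ) :
    polyNumCollisions G σ γ a b = (h.locFinite a b).toFinset.card := by
  rw [polyNumCollisions, Set.ncard_eq_toFinset_card _ (h.locFinite a b)]

/-- A polydisperse trajectory with no collision in `(s, t]` is free flight there. [folklore] -/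
theorem eq_freeFlight (h : IsPolyHardSphereTrajectory G m σ γ) {s t : ℝ} (hst : s ≤ t)
    (hfree : ∀ τ ∈ Ioc s t, τ ∉ polyCollisionTimes G σ γ) :
    γ t = freeFlight G (t - s) (γ s) :=
  h.free s t hst hfree

/-- The mass-weighted kinetic energy does not change across a collision of a polydisperse
trajectory: at a collision time `t` with colliding pair `(i, j)` and left limit `z⁻`,
`E_m(γ t) = E_m(z⁻)`. [folklore] -/
theorem configEnergyMass_eq_of_collision (h : IsPolyHardSphereTrajectory G m σ γ) {t : ℝ}
    {i j : Fin N} (hij : i ≠ j) (hc : γ t ∈ polyContactSet G σ i j) :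
    ∃ zl, Tendsto γ (𝓝[<] t) (𝓝 zl) ∧ configEnergyMass m (γ t) = configEnergyMass m zl := by
  obtain ⟨-, zl, hzl, -, hγ⟩ := h.binary t i j hij hc
  exact ⟨zl, hzl, by rw [hγ, configEnergyMass_collidePairMass hij]⟩

end IsPolyHardSphereTrajectory

/-- Monodisperse embedding: a hard-sphere trajectory of diameter `ε > 0` is a polydisperse
trajectory with constant diameter `ε` and any constant nonzero mass `μ`. [folklore] -/
theorem IsHardSphereTrajectory.toPoly [TopologicalSpace X] {G : Geometry d X} {ε : ℝ} (hε : 0 < ε)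
    {μ : ℝ} (hμ : μ ≠ 0) {γ : ℝ → Config N d X} (h : IsHardSphereTrajectory G ε N γ) :
    IsPolyHardSphereTrajectory G (fun _ : Fin N => μ) (fun _ => ε) γ where
  mem t := by
    rw [polyHardSphereDomain_const]
    exact h.mem t
  locFinite a b := by
    rw [polyCollisionTimes_const G hε]
    exact h.locFinite a b
  pos_continuous := h.pos_continuous
  free s t hst hfree := h.free s t hst (by simpa only [polyCollisionTimes_const G hε] using hfree)
  binary t i j hij hc := by
    rw [polyContactSet_const G hε] at hc
    obtain ⟨huniq, zl, hzl, hin, hγ⟩ := h.binary t i j hij hc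
    refine ⟨fun i' j' hij' hc' => huniq i' j' hij' ?_, zl, hzl, hin, ?_⟩
    · rwa [polyContactSet_const G hε] at hc'
    · rw [collidePairMass_const hμ]
      exact hγ

variable [MeasureSpace X] [TopologicalSpace X]

/-- The global polydisperse hard-body flow with masses `m` and diameters `σ` in the geometry `G`,
bundled with its defining properties (an Alexander-type theorem — AMP 2022 Thm 3.1 for two
species in `ℝ^d`; the shape of `HardSphereFlow`): a measurable, invariant *good set* `good` of
full Liouville (Lebesgue) measure in the mixture domain, on which `flow` is a one-parameter group
of polydisperse hard-body trajectories, each `flow t` being measurable and preserving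
`polyLiouville G σ`. Outside `good` the values of `flow` are unspecified. Existence: the named
facts of `PolydisperseHardSphereAlexander`; the monodisperse case is `HardSphereFlow.toPoly`. [cite: AmpatzoglouMillerPavlovic2022, §3 Thm 3.1] -/
structure PolydisperseHardSphereFlow (G : Geometry d X) (m σ : Fin N → ℝ) where
  /-- The flow map `(t, z) ↦ Ψ_t z`. -/
  flow : ℝ → Config N d X → Config N d X
  /-- The good set of initial data on which the dynamics is globally defined. -/
  good : Set (Config N d X)
  /-- The good set is measurable. -/
  measurableSet_good : MeasurableSet good
  /-- The good set lies in the mixture domain. -/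
  good_subset : good ⊆ polyHardSphereDomain G σ
  /-- The good set has full Liouville measure. -/
  measure_compl_good : polyLiouville G σ goodᶜ = 0
  /-- The good set is invariant under the flow. -/
  mapsTo_good : ∀ t, MapsTo (flow t) good good
  /-- `Ψ_0 = id` on the good set. -/
  flow_zero : ∀ z ∈ good, flow 0 z = z
  /-- The group property `Ψ_{s+t} = Ψ_s ∘ Ψ_t` on the good set. -/
  flow_add : ∀ s t, ∀ z ∈ good, flow (s + t) z = flow s (flow t z)
  /-- Each time-`t` map is measurable. -/
  measurable_flow : ∀ t, Measurable (flow t)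
  /-- Orbits of good points are polydisperse hard-body trajectories. -/
  isTrajectory : ∀ z ∈ good, IsPolyHardSphereTrajectory G m σ fun t => flow t z
  /-- Each time-`t` map preserves the Liouville measure. -/
  measurePreserving : ∀ t, MeasurePreserving (flow t) (polyLiouville G σ) (polyLiouville G σ)

namespace PolydisperseHardSphereFlow

variable {G : Geometry d X} {m σ : Fin N → ℝ}

/-- A polydisperse flow coerces to its flow map. [folklore] -/
instance instCoeFun :
    CoeFun (PolydisperseHardSphereFlow G m σ) fun _ => ℝ → Config N d X → Config N d X :=
  ⟨PolydisperseHardSphereFlow.flow⟩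

/-- Liouville-almost every configuration is good. [folklore] -/
theorem ae_mem_good (Ψ : PolydisperseHardSphereFlow G m σ) :
    ∀ᵐ z ∂polyLiouville G σ, z ∈ Ψ.good :=
  Ψ.measure_compl_good

/-- On the good set `Ψ_{-t}` inverts `Ψ_t`. [folklore] -/
theorem flow_neg_flow (Ψ : PolydisperseHardSphereFlow G m σ) (t : ℝ) {z : Config N d X}
    (hz : z ∈ Ψ.good) : Ψ.flow (-t) (Ψ.flow t z) = z := by
  rw [← Ψ.flow_add (-t) t z hz, neg_add_cancel, Ψ.flow_zero z hz]

/-- On the good set `Ψ_t` inverts `Ψ_{-t}`. [folklore] -/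
theorem flow_flow_neg (Ψ : PolydisperseHardSphereFlow G m σ) (t : ℝ) {z : Config N d X}
    (hz : z ∈ Ψ.good) : Ψ.flow t (Ψ.flow (-t) z) = z := by
  simpa using Ψ.flow_neg_flow (-t) hz

/-- Good orbits stay in the mixture domain. [folklore] -/
theorem flow_mem_polyHardSphereDomain (Ψ : PolydisperseHardSphereFlow G m σ) (t : ℝ)
    {z : Config N d X} (hz : z ∈ Ψ.good) : Ψ.flow t z ∈ polyHardSphereDomain G σ :=
  Ψ.good_subset (Ψ.mapsTo_good t hz)

/-- The transport of a real function along the flow: `(S_t W)(z) = W (Ψ_{-t} z)`. [folklore] -/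
def transportFn (Ψ : PolydisperseHardSphereFlow G m σ) (W : Config N d X → ℝ) (t : ℝ) :
    Config N d X → ℝ :=
  fun z => W (Ψ.flow (-t) z)

/-- Unfolding lemma for `transportFn`. [folklore] -/
@[simp]
theorem transportFn_apply (Ψ : PolydisperseHardSphereFlow G m σ) (W : Config N d X → ℝ) (t : ℝ)
    (z : Config N d X) : Ψ.transportFn W t z = W (Ψ.flow (-t) z) := rfl

/-- The law at time `t` of the system started from the initial law `P₀`: the push-forward
`(Ψ_t)_* P₀`. [folklore] -/
def lawAt (Ψ : PolydisperseHardSphereFlow G m σ) (P₀ : Measure (Config N d X)) (t : ℝ) :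
    Measure (Config N d X) :=
  P₀.map (Ψ.flow t)

/-- Unfolding lemma for `lawAt`. [folklore] -/
@[simp]
theorem lawAt_eq (Ψ : PolydisperseHardSphereFlow G m σ) (P₀ : Measure (Config N d X)) (t : ℝ) :
    Ψ.lawAt P₀ t = P₀.map (Ψ.flow t) := rfl

/-- The Liouville measure is invariant (restatement of `measurePreserving`). [folklore] -/
theorem lawAt_polyLiouville (Ψ : PolydisperseHardSphereFlow G m σ) (t : ℝ) :
    Ψ.lawAt (polyLiouville G σ) t = polyLiouville G σ :=
  (Ψ.measurePreserving t).map_eq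

/-- Pre-images of null sets under `Ψ_t` are null (from `measurePreserving`). [folklore] -/
theorem measure_preimage_null (Ψ : PolydisperseHardSphereFlow G m σ) (t : ℝ) {s : Set (Config N d X)}
    (hs : polyLiouville G σ s = 0) : polyLiouville G σ (Ψ.flow t ⁻¹' s) = 0 :=
  (Ψ.measurePreserving t).preimage_null hs

end PolydisperseHardSphereFlow

/-- Monodisperse embedding: a hard-sphere flow of diameter `ε > 0` (unit masses) is a polydisperse
hard-body flow with constant diameter `ε` and any constant nonzero mass `μ` (same flow map and
good set). In particular the hard-sphere flows constructed in `HardSphereAlexander` /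
`HardSphereEuclideanAlexander` inhabit the polydisperse structure. [folklore] -/
def HardSphereFlow.toPoly {G : Geometry d X} {ε : ℝ} (hε : 0 < ε) {μ : ℝ} (hμ : μ ≠ 0)
    (Φ : HardSphereFlow G ε N) :
    PolydisperseHardSphereFlow G (fun _ : Fin N => μ) (fun _ => ε) where
  flow := Φ.flow
  good := Φ.good
  measurableSet_good := Φ.measurableSet_good
  good_subset := by
    rw [polyHardSphereDomain_const]
    exact Φ.good_subset
  measure_compl_good := by
    rw [polyLiouville_const]
    exact Φ.measure_compl_good
  mapsTo_good := Φ.mapsTo_good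
  flow_zero := Φ.flow_zero
  flow_add := Φ.flow_add
  measurable_flow := Φ.measurable_flow
  isTrajectory z hz := (Φ.isTrajectory z hz).toPoly hε hμ
  measurePreserving t := by
    rw [polyLiouville_const]
    exact Φ.measurePreserving t

/-- Unfolding lemma: the embedded flow map is the original one. [folklore] -/
@[simp]
theorem HardSphereFlow.toPoly_flow {G : Geometry d X} {ε : ℝ} (hε : 0 < ε) {μ : ℝ} (hμ : μ ≠ 0)
    (Φ : HardSphereFlow G ε N) : (Φ.toPoly hε hμ).flow = Φ.flow := rfl

/-- Unfolding lemma: the embedded good set is the original one. [folklore] -/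
@[simp]
theorem HardSphereFlow.toPoly_good {G : Geometry d X} {ε : ℝ} (hε : 0 < ε) {μ : ℝ} (hμ : μ ≠ 0)
    (Φ : HardSphereFlow G ε N) : (Φ.toPoly hε hμ).good = Φ.good := rfl

end Flow

end

end Literature.Analysis.FluidPDE
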